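import Summits.MatrixMultiplication.OmegaCensus.VertexCountingLawShape
import Summits.MatrixMultiplication.OmegaCensus.DihedralLikeLawGap
import HarnessLib

/-!
# Only `D_{2N}` attains the dihedral-like law — without the parity hypothesis

ω-census, family (b3).  Framing: lottery ticket; floor = certified bounds/negative ranges.

`DihedralLawAttainedCyclic.zmultiples_of_law_attained` (a TPP triple with `3|S||T||U| + 4 = 8|A|` forces `A`
cyclic) and the corollaries in `DihedralLikeLawGap.lean` assume `|A|` even, because the size classification
`parts_law_shape` behind them does.  The eight vertex constraints give the law shape for every `|A|`
(`law_shape_of_vertex_bounds`), so the parity hypothesis can be dropped — and so can `|A| ≡ 2 (mod 3)`, which is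
forced by `3V + 4 = 8|A|`:

* `zmultiples_of_law_attained'`: dihedral-like presentation over `A` with `|A| ≥ 14`, TPP triple with
  `3|S||T||U| + 4 = 8|A|` ⟹ `A` is cyclic;
* `cyclic_and_c0_zero_of_law'`: … and `c₀ = 0`, i.e. `G` is the dihedral group `D_{2|A|}`;
* `tpp_volume_le_law_sub_four_of_not_dihedral'`: `|A| ≡ 2 (mod 3)`, `|A| ≥ 14`, `A` not cyclic or `c₀ ≠ 0` ⟹
  `3|S||T||U| + 16 ≤ 8|A|` (`β ≤ 8⌊|A|/3⌋`), now also for odd `|A|` (e.g. `Dih(ℤ₅ × ℤ₂₅)`, `Dih(ℤ₅³)`).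
-/

namespace Summit.MatrixMultiplication.OmegaCensus

open Literature.Combinatorics.Additive Finset

section DihedralLike

variable {A : Type*} [AddCommGroup A] [DecidableEq A] [Fintype A] {G : Type} [Group G] [DecidableEq G]
  {ρ τ : A → G} {c₀ : A} {S T U : Finset G}

/-- **The law is attained only over cyclic `A`** (any parity; `|A| ≥ 14`). [folklore] -/
theorem zmultiples_of_law_attained'
    (hρρ : ∀ a b, ρ a * ρ b = ρ (a + b)) (hρτ : ∀ a b, ρ a * τ b = τ (b - a))
    (hτρ : ∀ a b, τ a * ρ b = τ (a + b)) (hττ : ∀ a b, τ a * τ b = ρ (c₀ + b - a))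
    (hρ : Function.Injective ρ) (hτ : Function.Injective τ) (hne : ∀ a b, ρ a ≠ τ b)
    (hsurj : ∀ g, (∃ a, ρ a = g) ∨ (∃ a, τ a = g)) (hA : 14 ≤ Fintype.card A) (h : TripleProductProperty S T U)
    (hV : 3 * (S.card * T.card * U.card) + 4 = 8 * Fintype.card A) :
    ∃ g : A, ∀ x : A, x ∈ AddSubgroup.zmultiples g := by
  obtain ⟨h000, h111, h100, h011, h010, h101, h001, h110⟩ := vertex_counting' hρρ hρτ hτρ hττ hρ hτ hne h
  rw [card_eq_parts' hρ hτ hne hsurj S, card_eq_parts' hρ hτ hne hsurj T, card_eq_parts' hρ hτ hne hsurj U] at hV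
  rcases law_shape_of_vertex_bounds (Fintype.card A) _ _ _ _ _ _ h000 h111 h100 h011 h010 h101 h001 h110
      (by omega) hV with
    ⟨hs₀, hs₁, ht₀, ht₁, hu⟩ | ⟨hu₀, hu₁, hs₀, hs₁, ht⟩ | ⟨ht₀, ht₁, hu₀, hu₁, hs⟩
  · exact cyclic_of_law_shape hρρ hρτ hτρ hττ hρ hτ hne h hs₀ hs₁ ht₀ ht₁ hu
  · -- `T` is the big set: rotate to `(U, S, T)`
    exact cyclic_of_law_shape hρρ hρτ hτρ hττ hρ hτ hne h.rotate.rotate hu₀ hu₁ hs₀ hs₁ ht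
  · -- `S` is the big set: rotate to `(T, U, S)`
    exact cyclic_of_law_shape hρρ hρτ hτρ hττ hρ hτ hne h.rotate ht₀ ht₁ hu₀ hu₁ hs

/-- **Only `D_{2N}` attains the law** (any parity): `3|S||T||U| + 4 = 8|A|`, `|A| ≥ 14` ⟹ `A` cyclic and
`c₀ = 0`. [folklore] -/
theorem cyclic_and_c0_zero_of_law'
    (hρρ : ∀ a b, ρ a * ρ b = ρ (a + b)) (hρτ : ∀ a b, ρ a * τ b = τ (b - a))
    (hτρ : ∀ a b, τ a * ρ b = τ (a + b)) (hττ : ∀ a b, τ a * τ b = ρ (c₀ + b - a))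
    (hρ : Function.Injective ρ) (hτ : Function.Injective τ) (hne : ∀ a b, ρ a ≠ τ b)
    (hsurj : ∀ g, (∃ a, ρ a = g) ∨ (∃ a, τ a = g)) (hA : 14 ≤ Fintype.card A) (h : TripleProductProperty S T U)
    (hV : 3 * (S.card * T.card * U.card) + 4 = 8 * Fintype.card A) :
    (∃ g : A, ∀ x : A, x ∈ AddSubgroup.zmultiples g) ∧ c₀ = 0 := by
  refine ⟨zmultiples_of_law_attained' hρρ hρτ hτρ hττ hρ hτ hne hsurj hA h hV, ?_⟩
  by_contra hc
  have := tpp_volume_le_law_dicyclicLike hρρ hρτ hτρ hττ hρ hτ hne hsurj (two_c0_eq_zero hρτ hτρ hττ hτ) hc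
    (by omega) hA h
  omega

/-- **`β ≤ 8⌊|A|/3⌋` for every dihedral-like group other than `D_{2N}`** (`|A| ≡ 2 (mod 3)`, `|A| ≥ 14`, any
parity): `A` not cyclic or `c₀ ≠ 0` ⟹ `3|S||T||U| + 16 ≤ 8|A|`. [folklore] -/
theorem tpp_volume_le_law_sub_four_of_not_dihedral'
    (hρρ : ∀ a b, ρ a * ρ b = ρ (a + b)) (hρτ : ∀ a b, ρ a * τ b = τ (b - a))
    (hτρ : ∀ a b, τ a * ρ b = τ (a + b)) (hττ : ∀ a b, τ a * τ b = ρ (c₀ + b - a))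
    (hρ : Function.Injective ρ) (hτ : Function.Injective τ) (hne : ∀ a b, ρ a ≠ τ b)
    (hsurj : ∀ g, (∃ a, ρ a = g) ∨ (∃ a, τ a = g)) (hmod : Fintype.card A % 3 = 2) (hA : 14 ≤ Fintype.card A)
    (hnot : (¬ ∃ g : A, ∀ x : A, x ∈ AddSubgroup.zmultiples g) ∨ c₀ ≠ 0) (h : TripleProductProperty S T U) :
    3 * (S.card * T.card * U.card) + 16 ≤ 8 * Fintype.card A := by
  rcases tpp_volume_law_or_le_law_sub_four hρρ hρτ hτρ hττ hρ hτ hne hsurj hmod hA h with hV | hV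
  · obtain ⟨hcyc, hc⟩ := cyclic_and_c0_zero_of_law' hρρ hρτ hτρ hττ hρ hτ hne hsurj hA h hV
    rcases hnot with hnc | hc0
    · exact absurd hcyc hnc
    · exact absurd hc hc0
  · exact hV

end DihedralLike

end Summit.MatrixMultiplication.OmegaCensus
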